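import Summits.QuantumFields.BalabanUV.Beta.GAN24.SymContactLambdaEntryBound
import Summits.QuantumFields.BalabanUV.Beta.GAN24.BornLambdaContactPairCells

/-!
# `BalabanUV.Beta.GAN24.SymBornLambdaContactPairCells` — binder row G-an2-4 ∕ (CONV-C), TRANSFER-III, the (III′) S-slot (b) of the END, born-Λ contact PAIR `hPc` (road-P2 M.104's 4th
# hypothesis), TABLE HALF («mksym lane»), PAIR PART 1: **THE TWO Λ CONTACT CELLS AT an1's (0.4)-SYMMETRISED ROOTED AVERAGING ARE (MULTI)LINEAR SLOT BY SLOT, AND THE ΔΔ CELL WITH TWO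
# AMPLITUDES** — the decl-by-decl twin of MY g61 `BornLambdaContactPairCells` with `linAvgAt ↦ symLinAvgAt`, `linCountAt ↦ symLinCountAt` (`symLinAvgAt_sub` from an1's `symAxial_sub` ∕
# `segUp_sum_sub`; `Cnt ↦ (2Lc)^{d+1}·((d+1)·((d+1)!·(Lc^{d+1}·ℓ)))`), over MY PARTs 2∕8 (`SymContactFaceJumpCommutator`, `SymContactLambdaEntryBound`) and the table-free (E) letters BY NAME
# (G-an2-4 CRUX TEAM (2), leaf prover `b2b-balaban-gan24-formalise-leaf-01`, gen 90)

WHAT IS PROVED (generic `d`; [folklore]): §1 `symLinAvgAt_sub` (every root offset), **`commutator_sub_commutator`** (`COMM_sym(ψ′; R′) − COMM_sym(ψ; R) = COMM_sym(ψ′ − ψ; R′) + COMM_sym(ψ; R′ − R)`);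
(`cell_sub_cell ∕ sum_tsum_cell_sub_cell` are MY (E) ones BY NAME); §2 **`abs_commutator_dz_le_of_staircase_of_env₂`**, **`abs_sum_tsum_dz_le₂`** (the ΔΔ cell with two amplitudes at the sym table).
NOT HERE: the mixed∕ΔΔ pair cells (PAIR PART 2), the pair entry bound (PAIR PART 3), any count.

NOT IN PRINT; OUR BOOKKEEPING ([folklore]; 0 `def`, 0 cited fact, 0 `def … : Prop`, 0 sorry).  HONEST FRAMING (cell contract, verbatim): «discharging `BetaPertH` makes
Bałaban's UV stability UNCONDITIONAL — a real constructive-QFT result; it is NOT the continuum limit and NOT the Clay problem.»  HONEST DEPENDENCY (verbatim): «continuum YM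
on T⁴ ⇐ BetaPertH ∧ nine spine estimates (0/9 proved); BetaPertH ⇐ (D1) ∧ (D4) ∧ CAP+tail; G-an2-4 gates asym, D1 and NE2/3/4.»  Discharges NO letter of M.104 by itself;
NEVER «G-an2-4 closed» as (CONV-C); NOT D1, NOT `BetaPertH`, NOT continuum, NOT Clay.  2026-08-28; no existing file touched.
-/

noncomputable section

open Finset
open scoped BigOperators
open Literature.MathematicalPhysics.QuantumFieldTheory
open Literature.MathematicalPhysics.QuantumFieldTheory.LatticeForm (quo)
open Literature.MathematicalPhysics.QuantumFieldTheory.Balaban1983to89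
open Literature.MathematicalPhysics.QuantumFieldTheory.Balaban1983to89.Beta
open B4ContourShift (supNorm supNorm_nonneg)
open ExpKernelCalculus (Zl Zl_nonneg)
open AffineAveraging (Form0 Form1 Site box toSite unitVec dz)
open AveragingContours (blk)
open AveragingContours (segUp_sum_sub)
open AveragingHessianKernels (ell)
open Summit.QuantumFields.BalabanUV.Beta.SymmetrisedAxialPotential (symLinAvgAt symAxial_sub)
open Summit.QuantumFields.BalabanUV.Beta.SymAveragingHessianCounts (symLinCountAt)
open Summit.QuantumFields.BalabanUV.Beta.LinearGaugeVH (nearBox mem_nearBox)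
open Summit.QuantumFields.BalabanUV.Beta.GAN24.SymContactFaceJumpCommutator (abs_commutator_dz_le_of_staircase_of_le)
open Summit.QuantumFields.BalabanUV.Beta.GAN24.ContactLambdaCellBound (abs_sum_tsum_mul_le_of_env3)
open Summit.QuantumFields.BalabanUV.Beta.GAN24.ContactGaugeStaircaseLocal (env_label_le corner_le_of_mem_nearBox abs_weight_finest_le_env abs_dz_finest_le_env
  sum_abs_jump_le_env)
open Summit.QuantumFields.BalabanUV.Beta.GAN24.SymContactLambdaEntryBound (sum_abs_symLinCountAt_le_cnt)
open Summit.QuantumFields.BalabanUV.Beta.GAN24.ContactLambdaEntryBound (mul_sum_ite)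
open Summit.QuantumFields.BalabanUV.Beta.GAN24.BornLambdaContactPairCells (cell_sub_cell sum_tsum_cell_sub_cell)

namespace Summit.QuantumFields.BalabanUV.Beta.GAN24.SymBornLambdaContactPairCells

variable {d : ℕ} {Lc : ℕ} {rr : Fin (d + 1) → ℕ}

/-! ## §1 The cells are (multi)linear slot by slot -/

section Linear

/-- [folklore] an1's symmetrised rooted averaging is linear in the form (differences; every root offset `ρ`): `symAxial_sub`, `segUp_sum_sub`. -/
theorem symLinAvgAt_sub (ρ : Site (d + 1)) (A A' : Form1 (d + 1) ℝ) (L : ℕ) (μ : Fin (d + 1)) (y : Site (d + 1)) :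
    symLinAvgAt ρ (A - A') L μ y = symLinAvgAt ρ A L μ y - symLinAvgAt ρ A' L μ y := by
  unfold symLinAvgAt
  rw [← Finset.sum_sub_distrib]
  refine Finset.sum_congr rfl fun b _ => ?_
  rw [symAxial_sub, symAxial_sub, segUp_sum_sub]
  ring

/-- [folklore] **THE COMMUTATOR FACTOR IS LINEAR IN THE GAUGE WEIGHT AND IN THE LEG**: for every root, every `μ y`,
`COMM(ψ′; R′) − COMM(ψ; R) = COMM(ψ′ − ψ; R′) + COMM(ψ; R′ − R)` with the differenced slots written as the functions `fun x ↦ ψ′ x − ψ x`, `fun a x ↦ R′ a x − R a x`. -/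
theorem commutator_sub_commutator (ρ : Site (d + 1)) (Lc : ℕ) (ψ' ψ : Site (d + 1) → ℝ) (R' R : Form1 (d + 1) ℝ) (μ : Fin (d + 1)) (y : Site (d + 1)) :
    (symLinAvgAt ρ (fun a x => (ψ' x + ψ' (x + unitVec a)) * R' a x) Lc μ y
        - (ψ' ((Lc : ℤ) • y + ρ) + ψ' ((Lc : ℤ) • y + ρ + (Lc : ℤ) • unitVec μ)) * symLinAvgAt ρ R' Lc μ y)
      - (symLinAvgAt ρ (fun a x => (ψ x + ψ (x + unitVec a)) * R a x) Lc μ y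
        - (ψ ((Lc : ℤ) • y + ρ) + ψ ((Lc : ℤ) • y + ρ + (Lc : ℤ) • unitVec μ)) * symLinAvgAt ρ R Lc μ y)
      = (symLinAvgAt ρ (fun a x => ((fun x => ψ' x - ψ x) x + (fun x => ψ' x - ψ x) (x + unitVec a)) * R' a x) Lc μ y
          - ((fun x => ψ' x - ψ x) ((Lc : ℤ) • y + ρ) + (fun x => ψ' x - ψ x) ((Lc : ℤ) • y + ρ + (Lc : ℤ) • unitVec μ))
            * symLinAvgAt ρ R' Lc μ y)
        + (symLinAvgAt ρ (fun a x => (ψ x + ψ (x + unitVec a)) * (fun a x => R' a x - R a x) a x) Lc μ y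
          - (ψ ((Lc : ℤ) • y + ρ) + ψ ((Lc : ℤ) • y + ρ + (Lc : ℤ) • unitVec μ)) * symLinAvgAt ρ (fun a x => R' a x - R a x) Lc μ y) := by
  -- the three rooted averagings of differences as differences of rooted averagings
  have e1 : symLinAvgAt ρ (fun a x => ((fun x => ψ' x - ψ x) x + (fun x => ψ' x - ψ x) (x + unitVec a)) * R' a x) Lc μ y
      = symLinAvgAt ρ (fun a x => (ψ' x + ψ' (x + unitVec a)) * R' a x) Lc μ y - symLinAvgAt ρ (fun a x => (ψ x + ψ (x + unitVec a)) * R' a x) Lc μ y := by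
    rw [← symLinAvgAt_sub]
    exact congrArg (fun A => symLinAvgAt ρ A Lc μ y) (by funext a x; simp only [Pi.sub_apply]; ring)
  have e2 : symLinAvgAt ρ (fun a x => (ψ x + ψ (x + unitVec a)) * (fun a x => R' a x - R a x) a x) Lc μ y
      = symLinAvgAt ρ (fun a x => (ψ x + ψ (x + unitVec a)) * R' a x) Lc μ y - symLinAvgAt ρ (fun a x => (ψ x + ψ (x + unitVec a)) * R a x) Lc μ y := by
    rw [← symLinAvgAt_sub]
    exact congrArg (fun A => symLinAvgAt ρ A Lc μ y) (by funext a x; simp only [Pi.sub_apply]; ring)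
  have e3 : symLinAvgAt ρ (fun a x => R' a x - R a x) Lc μ y = symLinAvgAt ρ R' Lc μ y - symLinAvgAt ρ R Lc μ y := by
    rw [← symLinAvgAt_sub]
    rfl
  rw [e1, e2, e3]
  ring

end Linear

/-! ## §2 The ΔΔ cell with two amplitudes -/

section DeltaDelta

/-- NOT IN PRINT; OUR BOOKKEEPING ([folklore] over leaf-01 g60's `abs_commutator_dz_le_of_staircase_of_le`).  **THE ΔΔ COMMUTATOR LETTER WITH SEPARATE JUMP LETTERS**:
finest-piece weight of `ψ_a` `≤ W_a·E_a`, finest-piece gradient of `ψ_b` `≤ g_b·E_b` on the support box, jump sums `J_a ≤ F_a·E_a`, `J_b ≤ F_b·E_b`, count `≤ Cnt`: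
`|[𝒬^ρ_{Lc}, ψ̄_a](dz ψ_b)(μ,y)| ≤ (W_a·g_b + W_a·F_b + g_b·F_a)·(E_a·E_b·Cnt)` — every term carries ONE letter of EACH staircase. -/
theorem abs_commutator_dz_le_of_staircase_of_env₂ (hLc : 1 ≤ Lc) (hrr : rr ∈ box (d + 1) Lc) (Ga Gb : ℕ → Site (d + 1) → ℝ) (n : ℕ)
    {ψa ψb : Site (d + 1) → ℝ} (hψa : ∀ u, ψa u = ∑ s ∈ Finset.range (n + 1), Ga s (blk (Lc ^ s) u))
    (hψb : ∀ u, ψb u = ∑ s ∈ Finset.range (n + 1), Gb s (blk (Lc ^ s) u)) (μ : Fin (d + 1)) (y : Site (d + 1))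
    {Wa gb Fa Fb Ea Eb Cnt : ℝ} (hWa0 : 0 ≤ Wa) (hgb0 : 0 ≤ gb) (hEa : 0 ≤ Ea) (hEb : 0 ≤ Eb)
    (hWa : ∀ α, ∀ x ∈ nearBox Lc y, |Ga 0 x + Ga 0 (x + unitVec α) - Ga 0 ((Lc : ℤ) • y + toSite rr) - Ga 0 ((Lc : ℤ) • y + toSite rr + (Lc : ℤ) • unitVec μ)| ≤ Wa * Ea)
    (hgb : ∀ α, ∀ x ∈ nearBox Lc y, |dz (Gb 0) α x| ≤ gb * Eb)
    (hJa : ∑ s ∈ Finset.range n, |Ga (s + 1) (blk (Lc ^ s) (y + unitVec μ)) - Ga (s + 1) (blk (Lc ^ s) y)| ≤ Fa * Ea)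
    (hJb : ∑ s ∈ Finset.range n, |Gb (s + 1) (blk (Lc ^ s) (y + unitVec μ)) - Gb (s + 1) (blk (Lc ^ s) y)| ≤ Fb * Eb)
    (hCnt : ∑ x ∈ nearBox Lc y, ∑ α, |(symLinCountAt (toSite rr) Lc μ y (α, x) : ℝ)| ≤ Cnt) :
    |symLinAvgAt (toSite rr) (fun α x => (ψa x + ψa (x + unitVec α)) * dz ψb α x) Lc μ y
        - (ψa ((Lc : ℤ) • y + toSite rr) + ψa ((Lc : ℤ) • y + toSite rr + (Lc : ℤ) • unitVec μ)) * symLinAvgAt (toSite rr) (dz ψb) Lc μ y|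
      ≤ (Wa * gb + Wa * Fb + gb * Fa) * (Ea * Eb * Cnt) := by
  have h := abs_commutator_dz_le_of_staircase_of_le hLc hrr Ga Gb n n hψa hψb μ y (mul_nonneg hWa0 hEa) hWa hgb
  set Ja : ℝ := ∑ s ∈ Finset.range n, |Ga (s + 1) (blk (Lc ^ s) (y + unitVec μ)) - Ga (s + 1) (blk (Lc ^ s) y)| with hJadef
  set Jb : ℝ := ∑ s ∈ Finset.range n, |Gb (s + 1) (blk (Lc ^ s) (y + unitVec μ)) - Gb (s + 1) (blk (Lc ^ s) y)| with hJbdef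
  have hJa0 : 0 ≤ Ja := Finset.sum_nonneg fun _ _ => abs_nonneg _
  have hJb0 : 0 ≤ Jb := Finset.sum_nonneg fun _ _ => abs_nonneg _
  have hc0 : 0 ≤ ∑ x ∈ nearBox Lc y, ∑ α, |(symLinCountAt (toSite rr) Lc μ y (α, x) : ℝ)| :=
    Finset.sum_nonneg fun _ _ => Finset.sum_nonneg fun _ _ => abs_nonneg _
  refine h.trans ?_
  have hpre : Wa * Ea * (gb * Eb + Jb) + Ja * (gb * Eb) ≤ (Wa * gb + Wa * Fb + gb * Fa) * (Ea * Eb) := by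
    have h1 : Wa * Ea * Jb ≤ Wa * Ea * (Fb * Eb) := mul_le_mul_of_nonneg_left hJb (mul_nonneg hWa0 hEa)
    have h2 : Ja * (gb * Eb) ≤ (Fa * Ea) * (gb * Eb) := mul_le_mul_of_nonneg_right hJa (mul_nonneg hgb0 hEb)
    nlinarith
  have hpre0 : 0 ≤ Wa * Ea * (gb * Eb + Jb) + Ja * (gb * Eb) := by positivity
  calc (Wa * Ea * (gb * Eb + Jb) + Ja * (gb * Eb)) * ∑ x ∈ nearBox Lc y, ∑ α, |(symLinCountAt (toSite rr) Lc μ y (α, x) : ℝ)|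
      ≤ ((Wa * gb + Wa * Fb + gb * Fa) * (Ea * Eb)) * Cnt := mul_le_mul hpre hCnt hc0 (hpre0.trans hpre)
    _ = (Wa * gb + Wa * Fb + gb * Fa) * (Ea * Eb * Cnt) := by ring

variable {n : ℕ} {κ αa αb Tb : ℝ} {Ga Gb : ℕ → Site (d + 1) → ℝ} {ψa ψb : Site (d + 1) → ℝ}
  {b : Fin (d + 1) → Site (d + 1) → ℝ} {xg xl u' : Site (d + 1)}

/-- NOT IN PRINT; OUR BOOKKEEPING ([folklore]; leaf-02 g49's `ContactLambdaEntryBound.abs_sum_tsum_dz_le` with the two staircase letters SPLIT).  **THE ΔΔ CELL WITH TWO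
AMPLITUDES**: gauge staircases `ψ_a`, `ψ_b` of depth `n+1` with localised geometric pieces of amplitudes `α_a` (source `x_g`) and `α_b` (source `x_l`), brackets under the tent
letter `T_b`: every `y`-family is summable and
`|Σ_μ Σ'_y b μ y·[𝒬^ρ_{Lc}, ψ̄_a](dz ψ_b)(μ,y)| ≤ (d+1)·T_b·(E₀²·Cnt)·(8·α_a·α_b + 2·(6·α_a·α_b)·Lc·n)·((Lc^n)^{d+1}·Zl(κ∕(4(d+1))))·e^{−(κ∕12)(‖x_g − u′‖∞ + ‖x_l − u′‖∞)}`
— so a θ-small staircase in EITHER slot makes the ΔΔ cell θ-small (the contact PAIR's need, plan §3). -/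
theorem abs_sum_tsum_dz_le₂ (hLc : 1 ≤ Lc) (hrr : rr ∈ box (d + 1) Lc) (hκ : 0 < κ) (hαa : 0 ≤ αa) (hαb : 0 ≤ αb) (hTb : 0 ≤ Tb)
    (hψa : ∀ u, ψa u = ∑ s ∈ Finset.range (n + 1), Ga s (blk (Lc ^ s) u))
    (hψb : ∀ u, ψb u = ∑ s ∈ Finset.range (n + 1), Gb s (blk (Lc ^ s) u))
    (hGa : ∀ s, s ≤ n → ∀ u, |Ga s (blk (Lc ^ s) u)| ≤ αa * (Lc : ℝ) ^ s * Real.exp (-(κ * supNorm (quo (Lc ^ (n + 1)) u - xg))))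
    (hGb : ∀ s, s ≤ n → ∀ u, |Gb s (blk (Lc ^ s) u)| ≤ αb * (Lc : ℝ) ^ s * Real.exp (-(κ * supNorm (quo (Lc ^ (n + 1)) u - xl))))
    (hb : ∀ μ y, |b μ y| ≤ Tb * Real.exp (-(κ * supNorm (quo (Lc ^ n) y - u')))) :
    (∀ μ, Summable fun y : Site (d + 1) => b μ y *
        (symLinAvgAt (toSite rr) (fun a x => (ψa x + ψa (x + unitVec a)) * dz ψb a x) Lc μ y
          - (ψa ((Lc : ℤ) • y + toSite rr) + ψa ((Lc : ℤ) • y + toSite rr + (Lc : ℤ) • unitVec μ)) * symLinAvgAt (toSite rr) (dz ψb) Lc μ y)) ∧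
    |∑ μ, ∑' y : Site (d + 1), b μ y *
        (symLinAvgAt (toSite rr) (fun a x => (ψa x + ψa (x + unitVec a)) * dz ψb a x) Lc μ y
          - (ψa ((Lc : ℤ) • y + toSite rr) + ψa ((Lc : ℤ) • y + toSite rr + (Lc : ℤ) • unitVec μ)) * symLinAvgAt (toSite rr) (dz ψb) Lc μ y)|
      ≤ ((d : ℝ) + 1) * Tb * (Real.exp (2 * ((d : ℝ) + 1) * κ) ^ 2 *
            (((2 * Lc : ℕ) : ℝ) ^ (d + 1) * (((d + 1 : ℕ) : ℝ) * ((((d + 1).factorial : ℕ) : ℝ) * ((Lc : ℝ) ^ (d + 1) * (ell (d + 1) Lc : ℝ))))))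
          * (8 * (αa * αb) + 2 * (6 * (αa * αb)) * Lc * n) * ((((Lc ^ n : ℕ) : ℝ)) ^ (d + 1) * Zl (d + 1) (κ / (4 * ((d : ℝ) + 1)))) *
          Real.exp (-(κ / 12) * (supNorm (xg - u') + supNorm (xl - u'))) := by
  set E₀ : ℝ := Real.exp (2 * ((d : ℝ) + 1) * κ) with hE₀
  set Cnt : ℝ := ((2 * Lc : ℕ) : ℝ) ^ (d + 1) * (((d + 1 : ℕ) : ℝ) * ((((d + 1).factorial : ℕ) : ℝ) * ((Lc : ℝ) ^ (d + 1) * (ell (d + 1) Lc : ℝ)))) with hCnt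
  have hE₀0 : 0 ≤ E₀ := (Real.exp_pos _).le
  have hLn : 1 ≤ Lc ^ n := Nat.one_le_pow _ _ hLc
  have hc : ∀ μ y, |symLinAvgAt (toSite rr) (fun a x => (ψa x + ψa (x + unitVec a)) * dz ψb a x) Lc μ y
        - (ψa ((Lc : ℤ) • y + toSite rr) + ψa ((Lc : ℤ) • y + toSite rr + (Lc : ℤ) • unitVec μ)) * symLinAvgAt (toSite rr) (dz ψb) Lc μ y|
      ≤ (8 * (αa * αb) + ∑ s ∈ Finset.range n, (if (Lc : ℤ) ^ s ∣ y μ + 1 then 2 * ((fun m => 6 * (αa * αb) * (Lc : ℝ) ^ m) (s + 1)) else 0)) *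
        ((E₀ ^ 2 * Cnt) * Real.exp (-(κ * supNorm (quo (Lc ^ n) y - xg))) * Real.exp (-(κ * supNorm (quo (Lc ^ n) y - xl)))) := by
    intro μ y
    classical
    have hWa := fun a x (hx : x ∈ nearBox Lc y) => abs_weight_finest_le_env hLc hκ.le hαa hGa hrr μ y a hx
    have hgb := fun a x (hx : x ∈ nearBox Lc y) => abs_dz_finest_le_env hLc hκ.le hαb hGb y a hx
    have hJa := sum_abs_jump_le_env hLc hκ.le hαa hGa μ y
    have hJb := sum_abs_jump_le_env hLc hκ.le hαb hGb μ y
    have h := abs_commutator_dz_le_of_staircase_of_env₂ hLc hrr Ga Gb n hψa hψb μ y (Wa := 4 * αa) (gb := 2 * αb)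
      (Fa := ∑ s ∈ Finset.range n, (if (Lc : ℤ) ^ s ∣ y μ + 1 then 2 * (αa * (Lc : ℝ) ^ (s + 1)) else 0))
      (Fb := ∑ s ∈ Finset.range n, (if (Lc : ℤ) ^ s ∣ y μ + 1 then 2 * (αb * (Lc : ℝ) ^ (s + 1)) else 0))
      (Ea := E₀ * Real.exp (-(κ * supNorm (quo (Lc ^ n) y - xg)))) (Eb := E₀ * Real.exp (-(κ * supNorm (quo (Lc ^ n) y - xl))))
      (by positivity) (by positivity) (by positivity) (by positivity) hWa hgb hJa hJb
      (sum_abs_symLinCountAt_le_cnt hLc hrr μ y)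
    refine h.trans (le_of_eq ?_)
    have hF : (∑ s ∈ Finset.range n, (if (Lc : ℤ) ^ s ∣ y μ + 1 then 2 * ((fun m => 6 * (αa * αb) * (Lc : ℝ) ^ m) (s + 1)) else 0))
        = (4 * αa) * (∑ s ∈ Finset.range n, (if (Lc : ℤ) ^ s ∣ y μ + 1 then 2 * (αb * (Lc : ℝ) ^ (s + 1)) else 0))
          + (2 * αb) * (∑ s ∈ Finset.range n, (if (Lc : ℤ) ^ s ∣ y μ + 1 then 2 * (αa * (Lc : ℝ) ^ (s + 1)) else 0)) := by
      rw [mul_sum_ite, mul_sum_ite, ← Finset.sum_add_distrib]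
      refine Finset.sum_congr rfl fun s _ => ?_
      split_ifs
      · simp only []
        ring
      · ring
    rw [hF]
    ring
  have ha : ∀ s, s < n → 0 ≤ (fun m => 6 * (αa * αb) * (Lc : ℝ) ^ m) (s + 1) ∧
      (fun m => 6 * (αa * αb) * (Lc : ℝ) ^ m) (s + 1) ≤ (6 * (αa * αb)) * (Lc : ℝ) ^ (s + 1) :=
    fun s _ => ⟨by positivity, by show 6 * (αa * αb) * (Lc : ℝ) ^ (s + 1) ≤ 6 * (αa * αb) * (Lc : ℝ) ^ (s + 1); exact le_rfl⟩
  exact abs_sum_tsum_mul_le_of_env3 (d := d) (Lc := Lc) (M := Lc ^ n) (n := n) hLc hLn (fun s hs => pow_dvd_pow Lc hs.le) hκ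
    (a := fun m => 6 * (αa * αb) * (Lc : ℝ) ^ m) ha (b := b)
    (c := fun μ y => symLinAvgAt (toSite rr) (fun a x => (ψa x + ψa (x + unitVec a)) * dz ψb a x) Lc μ y
          - (ψa ((Lc : ℤ) • y + toSite rr) + ψa ((Lc : ℤ) • y + toSite rr + (Lc : ℤ) • unitVec μ)) * symLinAvgAt (toSite rr) (dz ψb) Lc μ y)
    hTb (by positivity : 0 ≤ E₀ ^ 2 * Cnt) (by positivity : (0 : ℝ) ≤ 8 * (αa * αb)) u' xg xl hb hc

end DeltaDelta

end Summit.QuantumFields.BalabanUV.Beta.GAN24.SymBornLambdaContactPairCells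

end
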